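import Summits.RiemannHypothesis.RiemannHypothesis.Theorems.Splittings.ScrewKreinDiscreteSymbol
import Summits.RiemannHypothesis.RiemannHypothesis.Theorems.Splittings.ScrewNodeReduction

/-!
# Screw index transfer, discrete Kreĭn core (5b/4+3): `K` negative squares on the MEAN-ZERO hyperplane; the definitizer `Q = P·X`

rh-split-screw-bridge g7, lane (xii-d) continuation «EXACT INDEX», file 5b (cut of `xiid/g7/ScrewExactIndexG7.lean` §14–§15; imports file 5a).

Why the `+1` of file 1's `negSqLE_BF_fC` (`NegSqLE (BF fC) (K+1)` from `IndexBounded K`) disappears on mean-zero vectors: the kernel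
form `Σ β_p β_q G(x_p,x_q)` and the point-mass form `Σ β_p β̄_q f(x_p − x_q)`, `f = −Ψ`, AGREE on mean-zero coefficient vectors
(`sum_fC_eq_sum_kernel`), and the kernel Gram matrix at ARBITRARY real nodes has at most `K` negative eigenvalues under `IndexBounded K`
(`negIndex_kernelMatrix_le`: augment the nodes by the free node `0`, where `G(·,0) = G(0,·) = 0`, to make a negative family mean-zero, then
the landed node reduction `ScrewBridgeG5.negIndex_ge_of_atomicWitness`).  Hence `NegSqLEOn (BF fC) K {mean zero}`
(`negSqLEOn_BF_fC_meanZero`), i.e. `NegSqLE B0 K` for the pull-back `B0` of `BF fC` to `V0 = ker E_0`; the difference operator maps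
everything into `V0` (`σ_η(0) = 0`), so the TREE's elementary `KreinStewart.abs_definitization` applied to `SDOp η|V0` gives `P ≠ 0`,
`deg P ≤ K`, and `Q := P·X` satisfies `Q ≠ 0`, `deg Q ≤ K+1`, `Q(0) = 0`, `Re BF fC (Q(SDOp η)v, Q(SDOp η)v) ≥ 0` for ALL `v`
(`exists_definitizer₀`).

Classification tags: [folklore] = standard analysis/algebra; [new-combination] = assembled here.
HONEST LABEL: SPLITTING SEARCH over kernel-typed RH-EQUIVALENCES; the exact index theorem relates two OPEN tail data (the screw
negative index and the number of distinct off-line zeros) and decides neither; nothing here bears on the truth of RH.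
-/

noncomputable section

set_option linter.dupNamespace false

namespace Summit.RiemannHypothesis.RiemannHypothesis.Theorems.Splittings.ScrewKreinDiscrete

open Finset Complex MeasureTheory Set Filter Topology Polynomial Module
open scoped ComplexConjugate Matrix
open Literature.NumberTheory.LFunctions
open Literature.Analysis.OperatorTheory
open Literature.Analysis.OperatorTheory.KreinStewart
open Summit.RiemannHypothesis.RiemannHypothesis.Theses.RuelleBand
open Summit.RiemannHypothesis.RiemannHypothesis.Theorems.IntegerScrew
open Summit.RiemannHypothesis.RiemannHypothesis.Theorems.Splittings.ScrewKreinCore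
open Summit.RiemannHypothesis.RiemannHypothesis.Theorems.Splittings.ScrewIndexTransferKrein

/-! ## §14 The mean-zero hyperplane: `K` negative squares, and a definitizer with the root `0` built in -/

/-- A real symmetric matrix with at least `q` negative eigenvalues carries `q` vectors (orthonormal eigenvectors) spanning a
subspace on which its quadratic form is negative definite. [folklore] -/
theorem exists_negFamily {r : ℕ} (A : Matrix (Fin r) (Fin r) ℝ) (hA : A.IsHermitian) (q : ℕ)
    (hq : q ≤ (univ.filter fun i => hA.eigenvalues i < 0).card) :
    ∃ α : Fin q → Fin r → ℝ, ∀ c : Fin q → ℝ, c ≠ 0 →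
      ∑ p, ∑ p', (∑ k, c k * α k p) * (∑ k, c k * α k p') * A p p' < 0 := by
  classical
  set N := {i : Fin r // hA.eigenvalues i < 0} with hNdef
  have hcardN : q ≤ Fintype.card N := by simpa [hNdef, Fintype.card_subtype] using hq
  -- an injection `Fin q ↪ N`
  obtain ⟨ι, hι⟩ : ∃ ι : Fin q → N, Function.Injective ι := by
    have e := (Fintype.equivFin N).symm
    exact ⟨fun k => e (Fin.castLE hcardN k), e.injective.comp (Fin.castLE_injective hcardN)⟩
  let e : Fin r → Fin r → ℝ := fun i => ⇑(hA.eigenvectorBasis i)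
  have he_orth : ∀ i j : Fin r, e i ⬝ᵥ e j = if i = j then 1 else 0 := by
    intro i j
    have h := (orthonormal_iff_ite.mp hA.eigenvectorBasis.orthonormal) j i
    rw [EuclideanSpace.inner_eq_star_dotProduct, star_trivial] at h
    rw [eq_comm] at h ⊢
    simpa [eq_comm] using h.symm
  have he_eig : ∀ i : Fin r, A *ᵥ e i = hA.eigenvalues i • e i := fun i => hA.mulVec_eigenvectorBasis i
  refine ⟨fun k => e (ι k), fun c hc => ?_⟩
  set y : Fin r → ℝ := fun p => ∑ k, c k * e (ι k) p with hy
  have hy' : y = ∑ k, c k • e (ι k) := by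
    funext p; rw [hy]; simp [Finset.sum_apply, Pi.smul_apply, smul_eq_mul]
  have h1 : ∑ p, ∑ p', y p * y p' * A p p' = y ⬝ᵥ (A *ᵥ y) := by
    simp only [dotProduct, Matrix.mulVec, Finset.mul_sum]
    refine Finset.sum_congr rfl fun p _ => Finset.sum_congr rfl fun p' _ => by ring
  have h2 : A *ᵥ y = ∑ k, (c k * hA.eigenvalues (ι k)) • e (ι k) := by
    rw [hy', Matrix.mulVec_sum]
    refine Finset.sum_congr rfl fun k _ => ?_
    rw [Matrix.mulVec_smul, he_eig, smul_smul]
  have h3 : ∀ k : Fin q, y ⬝ᵥ e (ι k) = c k := by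
    intro k
    rw [hy', sum_dotProduct]
    simp_rw [smul_dotProduct, he_orth, smul_eq_mul, mul_ite, mul_one, mul_zero]
    rw [Finset.sum_eq_single k]
    · rw [if_pos rfl]
    · intro b _ hb
      rw [if_neg (fun h => hb (hι (Subtype.ext h)))]
    · intro h; exact absurd (Finset.mem_univ k) h
  have hform : ∑ p, ∑ p', y p * y p' * A p p' = ∑ k, hA.eigenvalues (ι k) * c k ^ 2 := by
    rw [h1, h2, dotProduct_sum]
    refine Finset.sum_congr rfl fun k _ => ?_
    rw [dotProduct_smul, h3, smul_eq_mul]; ring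
  show ∑ p, ∑ p', y p * y p' * A p p' < 0
  rw [hform]
  obtain ⟨k₀, hk₀⟩ : ∃ k, c k ≠ 0 := by
    by_contra h
    exact hc (funext fun k => not_not.mp fun hk => h ⟨k, hk⟩)
  have hle : ∀ k ∈ (univ : Finset (Fin q)), hA.eigenvalues (ι k) * c k ^ 2 ≤ 0 := fun k _ =>
    mul_nonpos_iff.mpr (Or.inr ⟨le_of_lt (ι k).2, sq_nonneg _⟩)
  have hlt : ∃ k ∈ (univ : Finset (Fin q)), hA.eigenvalues (ι k) * c k ^ 2 < 0 :=
    ⟨k₀, Finset.mem_univ _, mul_neg_of_neg_of_pos (ι k₀).2 (lt_of_le_of_ne (sq_nonneg _) (Ne.symm (pow_ne_zero 2 hk₀)))⟩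
  simpa using Finset.sum_lt_sum hle hlt

/-- The real Gram matrix `[G(x_p, x_q)]` of Suzuki's kernel at arbitrary real nodes is symmetric. [folklore] -/
theorem kernelMatrix_isHermitian (r : ℕ) (x : Fin r → ℝ) :
    (Matrix.of fun p q : Fin r => zetaScrewKernel (x p) (x q)).IsHermitian := by
  refine Matrix.IsHermitian.ext fun p q => ?_
  simp only [Matrix.of_apply, star_trivial]
  exact zetaScrewKernel_comm _ _

/-- **Node reduction for the kernel form itself**: under `IndexBounded K`, the Gram matrix `[G(x_p,x_q)]` at ARBITRARY real nodes
has at most `K` negative eigenvalues (augment the nodes by the free node `0`, where `G(·,0) = G(0,·) = 0`, to make the negative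
family mean-zero; then `ScrewBridgeG5.negIndex_ge_of_atomicWitness`). [new-combination] -/
theorem negIndex_kernelMatrix_le (K : ℕ)
    (hK : ∀ n : ℕ, (univ.filter fun i => (screwMatrix_isHermitian n).eigenvalues i < 0).card ≤ K)
    (r : ℕ) (x : Fin r → ℝ) :
    (univ.filter fun i => (kernelMatrix_isHermitian r x).eigenvalues i < 0).card ≤ K := by
  classical
  by_contra h
  have hq : K + 1 ≤ (univ.filter fun i => (kernelMatrix_isHermitian r x).eigenvalues i < 0).card := by omega
  obtain ⟨α, hneg⟩ := exists_negFamily _ (kernelMatrix_isHermitian r x) (K + 1) hq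
  -- augmented nodes `x' = (0, x)` and mean-zero vectors `α' k = (−Σ α k, α k)`
  set x' : Fin (r + 1) → ℝ := Fin.cons 0 x with hx'
  set α' : Fin (K + 1) → Fin (r + 1) → ℝ := fun k => Fin.cons (-∑ p, α k p) (α k) with hα'
  have hmean : ∀ k, ∑ p, α' k p = 0 := by
    intro k
    rw [Fin.sum_univ_succ]
    simp [hα']
  have hform : ∀ c : Fin (K + 1) → ℝ,
      ∑ p, ∑ p', (∑ k, c k * α' k p) * (∑ k, c k * α' k p') * zetaScrewKernel (x' p) (x' p') =
        ∑ p, ∑ p', (∑ k, c k * α k p) * (∑ k, c k * α k p') * zetaScrewKernel (x p) (x p') := by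
    intro c
    rw [Fin.sum_univ_succ]
    have h0 : ∑ p', (∑ k, c k * α' k 0) * (∑ k, c k * α' k p') * zetaScrewKernel (x' 0) (x' p') = 0 := by
      refine Finset.sum_eq_zero fun p' _ => ?_
      rw [hx', Fin.cons_zero, zetaScrewKernel_zero_left, mul_zero]
    rw [h0, zero_add]
    refine Finset.sum_congr rfl fun p _ => ?_
    rw [Fin.sum_univ_succ]
    have h1 : (∑ k, c k * α' k p.succ) * (∑ k, c k * α' k 0) * zetaScrewKernel (x' p.succ) (x' 0) = 0 := by
      rw [hx', Fin.cons_zero, zetaScrewKernel_zero_right, mul_zero]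
    rw [h1, zero_add]
    refine Finset.sum_congr rfl fun p' _ => ?_
    simp only [hx', hα', Fin.cons_succ]
  have hneg' : ∀ c : Fin (K + 1) → ℝ, c ≠ 0 →
      ∑ p, ∑ p', (∑ k, c k * α' k p) * (∑ k, c k * α' k p') * zetaScrewKernel (x' p) (x' p') < 0 := by
    intro c hc
    rw [hform c]
    have := hneg c hc
    simpa only [Matrix.of_apply] using this
  obtain ⟨N, hN⟩ := ScrewBridgeG5.negIndex_ge_of_atomicWitness (K + 1) (r + 1) x' α' hmean hneg'
  have h1 := hN N le_rfl
  have h2 := hK N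
  omega

/-- The complexified kernel Gram matrix is Hermitian. [folklore] -/
theorem kernelMatrixC_isHermitian (r : ℕ) (x : Fin r → ℝ) :
    (Matrix.of fun p q : Fin r => (zetaScrewKernel (x p) (x q) : ℂ)).IsHermitian := by
  refine Matrix.IsHermitian.ext fun p q => ?_
  simp only [Matrix.of_apply, Complex.star_def, Complex.conj_ofReal]
  rw [zetaScrewKernel_comm]

/-- Complex form of `negIndex_kernelMatrix_le`. [folklore] -/
theorem negIndex_kernelMatrixC_le (K : ℕ)
    (hK : ∀ n : ℕ, (univ.filter fun i => (screwMatrix_isHermitian n).eigenvalues i < 0).card ≤ K)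
    (r : ℕ) (x : Fin r → ℝ) :
    (univ.filter fun i => (kernelMatrixC_isHermitian r x).eigenvalues i < 0).card ≤ K := by
  have hmat : (Matrix.of fun p q : Fin r => (zetaScrewKernel (x p) (x q) : ℂ)) =
      (Matrix.of fun p q : Fin r => zetaScrewKernel (x p) (x q)).map (algebraMap ℝ ℂ) := by
    ext p q
    simp only [Matrix.of_apply, Matrix.map_apply, Complex.coe_algebraMap]
  have hC : ((Matrix.of fun p q : Fin r => zetaScrewKernel (x p) (x q)).map (algebraMap ℝ ℂ)).IsHermitian := by
    rw [← hmat]; exact kernelMatrixC_isHermitian r x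
  rw [card_negEigenvalues_congr hmat _ hC, card_negEigenvalues_map_algebraMap _ (kernelMatrix_isHermitian r x) hC]
  exact negIndex_kernelMatrix_le K hK r x

/-- On a MEAN-ZERO coefficient vector the point-mass form of `f = −Ψ` is the kernel form of `G`. [folklore] -/
theorem sum_fC_eq_sum_kernel {n : ℕ} (x : Fin n → ℝ) (d : Fin n → ℂ) (hd : ∑ k, d k = 0) :
    ∑ k, ∑ l, d k * conj (d l) * fC (x k - x l) = ∑ k, ∑ l, d k * conj (d l) * (zetaScrewKernel (x k) (x l) : ℂ) := by
  have hd' : ∑ l, conj (d l) = 0 := by rw [← map_sum, hd, map_zero]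
  have hG : ∀ k l, fC (x k - x l) =
      (zetaScrewKernel (x k) (x l) : ℂ) - (zetaScrew (x k) : ℂ) - (zetaScrew (x l) : ℂ) := by
    intro k l
    rw [fC, zetaScrewKernel_def]
    push_cast
    ring
  simp_rw [hG, mul_sub, Finset.sum_sub_distrib]
  have h1 : ∑ k, ∑ l, d k * conj (d l) * (zetaScrew (x k) : ℂ) = 0 := by
    have : ∀ k, ∑ l, d k * conj (d l) * (zetaScrew (x k) : ℂ) = d k * (zetaScrew (x k) : ℂ) * ∑ l, conj (d l) := by
      intro k; rw [Finset.mul_sum]; exact Finset.sum_congr rfl fun l _ => by ring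
    simp [this, hd']
  have h2 : ∑ k, ∑ l, d k * conj (d l) * (zetaScrew (x l) : ℂ) = 0 := by
    rw [Finset.sum_comm]
    have : ∀ l, ∑ k, d k * conj (d l) * (zetaScrew (x l) : ℂ) = conj (d l) * (zetaScrew (x l) : ℂ) * ∑ k, d k := by
      intro l; rw [Finset.mul_sum]; exact Finset.sum_congr rfl fun k _ => by ring
    simp [this, hd]
  rw [h1, h2, sub_zero, sub_zero]

/-- **Mean-zero point-mass hypothesis**: among `K + 1` MEAN-ZERO coefficient vectors on any nodes, some non-trivial combination has
non-negative `f`-energy. [new-combination] -/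
theorem meanZero_pointMassH (K : ℕ)
    (hK : ∀ n : ℕ, (univ.filter fun i => (screwMatrix_isHermitian n).eigenvalues i < 0).card ≤ K)
    (n : ℕ) (x : Fin n → ℝ) (v : Fin (K + 1) → Fin n → ℂ) (hv : ∀ i, ∑ k, v i k = 0) :
    ∃ w : Fin (K + 1) → ℂ, w ≠ 0 ∧
      0 ≤ (∑ k, ∑ l, (∑ i, w i * v i k) * conj (∑ i, w i * v i l) * fC (x k - x l)).re := by
  classical
  obtain ⟨c, hc0, hc⟩ := exists_comb_re_energy_nonneg (kernelMatrixC_isHermitian n x) K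
    (negIndex_kernelMatrixC_le K hK n x) (fun i k => conj (v i k))
  refine ⟨fun i => conj (c i), ?_, ?_⟩
  · intro h
    apply hc0
    funext i
    have hi : conj (c i) = 0 := by simpa using congrFun h i
    simpa using hi
  · have hmean : ∑ k, (∑ i, conj (c i) * v i k) = 0 := by
      rw [Finset.sum_comm]
      exact Finset.sum_eq_zero fun i _ => by rw [← Finset.mul_sum, hv i, mul_zero]
    rw [sum_fC_eq_sum_kernel x _ hmean]
    convert hc using 2
    simp only [dotProduct, Matrix.mulVec, Matrix.of_apply]
    refine Finset.sum_congr rfl fun k _ => ?_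
    rw [Finset.mul_sum]
    refine Finset.sum_congr rfl fun l _ => ?_
    simp only [Pi.star_apply, Finset.sum_apply, Pi.smul_apply, smul_eq_mul, star_sum, star_mul',
      Complex.star_def, Complex.conj_conj, map_sum, map_mul]
    rw [zetaScrewKernel_comm]
    ring


/-! ## §15 Kreĭn's hypothesis with `K` (not `K + 1`) negative squares on the MEAN-ZERO hyperplane, and the definitizer `Q = X·P` -/

/-- `E_0` is the total mass `Σ_t x(t)`. -/
theorem El_zero_apply (x : ℝ →₀ ℂ) : El 0 x = ∑ t ∈ x.support, x t := by
  rw [El_apply]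
  exact Finset.sum_congr rfl fun t _ => by rw [zero_mul, Complex.exp_zero, mul_one]

/-- **IndexBounded K ⟹ `BF fC` has at most `K` negative squares on mean-zero vectors** (`KreinStewart.negSqLE_BF`'s
bookkeeping with the mean-zero point-mass hypothesis `meanZero_pointMassH`). [new-combination] -/
theorem negSqLEOn_BF_fC_meanZero (K : ℕ)
    (hK : ∀ n : ℕ, (univ.filter fun i => (screwMatrix_isHermitian n).eigenvalues i < 0).card ≤ K) :
    NegSqLEOn (BF fC) K {x | El 0 x = 0} := by
  classical
  intro u hu
  set T : Finset ℝ := Finset.univ.biUnion fun a => (u a).support with hTdef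
  set n : ℕ := T.card with hndef
  set e : Fin n ≃ T := T.equivFin.symm with hedef
  set x : Fin n → ℝ := fun k => (e k : ℝ) with hxdef
  have h1 : ∀ g : ℝ → ℂ, ∑ t ∈ T, g t = ∑ k : Fin n, g (x k) := by
    intro g
    rw [← Finset.sum_coe_sort T g, ← Equiv.sum_comp e (fun b : T => g (b : ℝ))]
  have hv : ∀ a, ∑ k, u a (x k) = 0 := by
    intro a
    have hsub : (u a).support ⊆ T := by
      rw [hTdef]; exact Finset.subset_biUnion_of_mem (fun a => (u a).support) (Finset.mem_univ a)
    rw [← h1 (fun t => u a t), ← Finset.sum_subset hsub (fun t _ ht => Finsupp.notMem_support_iff.1 ht),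
      ← El_zero_apply]
    exact hu a
  obtain ⟨w, hw, hpos⟩ := meanZero_pointMassH K hK n x (fun a k => u a (x k)) hv
  refine ⟨w, hw, ?_⟩
  set d : ℝ →₀ ℂ := ∑ a, w a • u a with hddef
  have hsupp : d.support ⊆ T := by
    intro s hs
    have hs' := Finsupp.support_finsetSum hs
    rw [Finset.mem_biUnion] at hs'
    rw [hTdef, Finset.mem_biUnion]
    obtain ⟨a, ha, hsa⟩ := hs'
    exact ⟨a, ha, Finsupp.support_smul hsa⟩
  have hd : ∀ s, d s = ∑ a, w a * u a s := by
    intro s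
    rw [hddef, Finsupp.finsetSum_apply]
    simp only [Finsupp.smul_apply, smul_eq_mul]
  rw [BF_apply, kf_eq fC hsupp hsupp]
  have key : ∑ s ∈ T, ∑ t ∈ T, conj (d s) * d t * fC (t - s)
      = ∑ k, ∑ l, (∑ i, w i * u i (x k)) * conj (∑ i, w i * u i (x l)) * fC (x k - x l) := by
    rw [Finset.sum_comm, h1]
    refine Finset.sum_congr rfl fun k _ => ?_
    rw [h1]
    refine Finset.sum_congr rfl fun l _ => ?_
    rw [hd, hd]
    ring
  rw [key]
  exact hpos

/-- The mean-zero hyperplane `V₀ = ker E_0`. -/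
def V0 : Submodule ℂ (ℝ →₀ ℂ) := LinearMap.ker (El 0)

/-- Membership in `V₀`: `x ∈ V₀ ↔ E_0(x) = 0`. -/
theorem mem_V0 {x : ℝ →₀ ℂ} : x ∈ V0 ↔ El 0 x = 0 := LinearMap.mem_ker

/-- `SDOp η` kills the mean: its range lies in `V₀` (`σ_η(0) = 0`). [folklore] -/
theorem SDOp_mem_V0 (η : ℝ) (x : ℝ →₀ ℂ) : SDOp η x ∈ V0 := by
  rw [mem_V0, El_SDOp, sig_zero, zero_mul]

/-- The difference operator restricted to `V₀`. -/
def SDOp0 (η : ℝ) : V0 →ₗ[ℂ] V0 := (SDOp η).restrict fun x (_ : x ∈ V0) => SDOp_mem_V0 η x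

/-- Powers of the restricted operator `SDOp0 η` agree with powers of `SDOp η` under the coercion `V₀ → (ℝ →₀ ℂ)`. -/
theorem coe_SDOp0_pow (η : ℝ) (j : ℕ) (v : V0) :
    (((SDOp0 η ^ j) v : V0) : ℝ →₀ ℂ) = (SDOp η ^ j) (v : ℝ →₀ ℂ) := by
  induction j with
  | zero => simp
  | succ j ih =>
    rw [pow_succ', pow_succ', Module.End.mul_apply, Module.End.mul_apply, ← ih]
    rfl

/-- Polynomials in the restricted operator agree with polynomials in `SDOp η` under the coercion. -/
theorem coe_aeval_SDOp0 (η : ℝ) (P : ℂ[X]) (v : V0) :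
    ((aeval (SDOp0 η) P v : V0) : ℝ →₀ ℂ) = aeval (SDOp η : Module.End ℂ (ℝ →₀ ℂ)) P (v : ℝ →₀ ℂ) := by
  rw [aeval_eq_sum_range, aeval_eq_sum_range, LinearMap.sum_apply, LinearMap.sum_apply, Submodule.coe_sum]
  refine Finset.sum_congr rfl fun j _ => ?_
  rw [LinearMap.smul_apply, LinearMap.smul_apply, Submodule.coe_smul, coe_SDOp0_pow]

/-- The form `BF fC` pulled back to `V₀`. -/
def B0 : HForm V0 := pb (BF fC) V0.subtype

/-- `B0` evaluates as `BF fC` on the underlying finitely supported functions. -/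
theorem B0_apply (x y : V0) : B0 x y = BF fC (x : ℝ →₀ ℂ) (y : ℝ →₀ ℂ) := rfl

/-- `BF fC` pulled back to `V₀` has at most `K` negative squares. [new-combination] -/
theorem negSqLE_B0 (K : ℕ)
    (hK : ∀ n : ℕ, (univ.filter fun i => (screwMatrix_isHermitian n).eigenvalues i < 0).card ≤ K) :
    NegSqLE B0 K := by
  intro u _
  obtain ⟨w, hw, hpos⟩ := negSqLEOn_BF_fC_meanZero K hK (fun a => (u a : ℝ →₀ ℂ)) (fun a => mem_V0.mp (u a).2)
  refine ⟨w, hw, ?_⟩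
  simpa only [B0_apply, Submodule.coe_sum, Submodule.coe_smul] using hpos

/-- The restricted operator agrees with `SDOp η` under the coercion. -/
theorem coe_SDOp0 (η : ℝ) (v : V0) : ((SDOp0 η v : V0) : ℝ →₀ ℂ) = SDOp η (v : ℝ →₀ ℂ) := rfl

/-- `SDOp0 η` is symmetric for the pulled-back form `B0`. -/
theorem isSymOp_SDOp0 (η : ℝ) : IsSymOp B0 (SDOp0 η) := by
  intro x y
  rw [B0_apply, B0_apply, coe_SDOp0, coe_SDOp0]
  exact isSymOp_SDOp fC η _ _

/-- The pulled-back form `B0` is symmetric. -/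
theorem isSymm_B0 : B0.IsSymm :=
  ⟨fun x y => by rw [B0_apply, B0_apply]; exact (isSymm_BF fC_symm).eq _ _⟩

/-- The `abs_definitization` polynomial of `SDOp η|V₀`: degree `≤ K`. [new-combination] -/
theorem exists_definitizer_V0 (K : ℕ)
    (hK : ∀ n : ℕ, (univ.filter fun i => (screwMatrix_isHermitian n).eigenvalues i < 0).card ≤ K) (η : ℝ) :
    ∃ P : ℂ[X], P ≠ 0 ∧ P.natDegree ≤ K ∧ ∀ v : V0, 0 ≤ (B0 (aeval (SDOp0 η) P v) (aeval (SDOp0 η) P v)).re :=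
  abs_definitization (V := V0) isSymm_B0 (isSymOp_SDOp0 η) (negSqLE_B0 K hK)

/-- **The definitizer with the root `0` built in.**  Under `IndexBounded K`, for every step `η` there is a polynomial `Q ≠ 0`,
`deg Q ≤ K + 1`, `Q(0) = 0`, with `Re BF fC (Q(SDOp η) v) (Q(SDOp η) v) ≥ 0` for ALL point-mass vectors `v`
(`Q = P · X` with `P` the `KreinStewart.abs_definitization` polynomial of `SDOp η|V₀`, degree `≤ K`). [new-combination] -/
theorem exists_definitizer₀ (K : ℕ)
    (hK : ∀ n : ℕ, (univ.filter fun i => (screwMatrix_isHermitian n).eigenvalues i < 0).card ≤ K) (η : ℝ) :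
    ∃ Q : ℂ[X], Q ≠ 0 ∧ Q.natDegree ≤ K + 1 ∧ Q.eval 0 = 0 ∧
      ∀ v : ℝ →₀ ℂ, 0 ≤ (BF fC (aeval (SDOp η : Module.End ℂ (ℝ →₀ ℂ)) Q v) (aeval (SDOp η : Module.End ℂ (ℝ →₀ ℂ)) Q v)).re := by
  obtain ⟨P, hP0, hdeg, hpos⟩ := exists_definitizer_V0 K hK η
  have hdeg' : (P * X).natDegree ≤ K + 1 := by rw [Polynomial.natDegree_mul_X hP0]; omega
  have hev : (P * X).eval 0 = 0 := by rw [Polynomial.eval_mul_X, mul_zero]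
  refine ⟨P * X, mul_ne_zero hP0 Polynomial.X_ne_zero, hdeg', hev, fun v => ?_⟩
  have h := hpos ⟨SDOp η v, SDOp_mem_V0 η v⟩
  rw [B0_apply, coe_aeval_SDOp0] at h
  rw [map_mul, Polynomial.aeval_X, Module.End.mul_apply]
  exact h

end Summit.RiemannHypothesis.RiemannHypothesis.Theorems.Splittings.ScrewKreinDiscrete
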